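import Mathlib.Analysis.Convex.PathConnected
import Mathlib.Combinatorics.SimpleGraph.Paths
import Mathlib.MeasureTheory.Constructions.BorelSpace.Basic
import Mathlib.Topology.CompactOpen
import Literature.Probability.LatticeModels.LatticeGraph
import Literature.Probability.Percolation.Percolation
import Literature.Probability.LatticeModels.DomainDiscretisation
import Literature.Probability.LatticeModels.TriangularLattice
import HarnessLib

-- provenance: harness21/H21/H21/Prelude/StatMech/LatticeInterface.lean @ ba91b93 (interim HEAD d8f2665); M5 mechanical rewrite
/-!
# Lattice interfaces as walks and continuous curves, I: polylines and hexagonal exploration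

Trunk: StatMech (prelude item P25 `LatticeInterface`, notion `lattice_interface_curve`, part 1;
outline designs D8, R4).

* `polyline l : C(unitInterval, E)`: the piecewise-linear curve through the points of a list
  `l` in a real topological vector space, built from Mathlib's `Path.segment` and `Path.trans`
  (so the time parametrisation is the *dyadic* one produced by iterated `trans`, not the uniform
  one; this is irrelevant modulo the reparametrisation quotient of the T-STOCH curve space).
  `SimpleGraph.Walk.toCurve emb w` is the polyline through the embedded support of a walk
  (a deliberate dot-notation extension of Mathlib's `SimpleGraph.Walk` namespace).
* `DiscreteDobrushin`: the data `(Ω, δ, A, B)` of a planar domain, a mesh size and two boundary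
  arcs (Dobrushin / two-arc boundary conditions); the arcs come from marked domains of T-STOCH.
* The hexagonal exploration path of critical site percolation on the triangular lattice `𝕋`
  (Smirnov, *Critical percolation in the plane*, C. R. Acad. Sci. Paris 333 (2001), §2;
  Camia–Newman, *Critical percolation exploration path and SLE₆*, Probab. Theory Related Fields
  139 (2007), §2): colours live on the sites of `𝕋` (= hexagons of the honeycomb lattice), with
  the sites of the discrete arc of `A` declared open and those of the arc of `B` declared closed
  (`DiscreteDobrushin.bcConfig`); the interface is a self-avoiding walk `γ` on the dual graph
  `hexGraph` every step of which crosses an edge of `Ω_δ` with an open site on its left and a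
  closed site on its right (`IsExplorationStep`, using `triEdgeFaces`) and which is *maximal*
  (no step enters its first face, none leaves its last face: `IsExplorationPath`). Under the
  admissibility hypotheses `DiscreteDobrushin.IsAdmissible` (arcs disjoint and covering `∂Ω_δ`,
  every `A`–`B` adjacency an edge of `Ω_δ`, exactly two outer `A`–`B` faces
  `DiscreteDobrushin.abFaces = {a_δ, b_δ}`) it runs from one outer face `a_δ` to the other
  `b_δ`, and
  `existsUnique_explorationPath` (sorried; planar topology, outline R4) makes
  `explorationWalk`/`explorationCurve` well defined; `explorationLaw D p` is the push-forward of
  `triSitePercolation p` to `C(unitInterval, ℂ)`.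
* `curveMeasurableSpace`: the Borel σ-algebra of the compact-open (= uniform) topology on
  `C(unitInterval, ℂ)`, as a *scoped* instance (Mathlib has no `MeasurableSpace` instance on
  `ContinuousMap`; grep for `MeasurableSpace C(`/`BorelSpace C(` returns nothing), with its
  `BorelSpace` instance.

Design choices. `polyline [] = 0` (junk constant) and `polyline [a]` is the constant curve; the
recursion goes through the auxiliary `polylineFrom a l : Σ b, Path a b` to keep track of the
endpoint needed by `Path.trans`. For a dart `f → g` of the hexagonal walk crossing the edge
`{x, y}` of `𝕋`, the site `x` is on the *left* of `f → g` iff the dart `x → y` of `𝕋` has left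
face `g` and right face `f`, i.e. `triEdgeFaces ⟨(x, y), _⟩ = (g, f)` (counter-clockwise
orientation of `ℂ`, as in `triEdgeFaces`). `explorationCurve` returns the junk constant curve `0`
when no (unique) exploration path exists; `explorationLaw` is a `Measure.map` and hence `0` if
`explorationCurve D` fails to be (AE-)measurable — measurability is assumed/known (for bounded `Ω`
and `δ > 0` the map has finite range), outline §0.

Mathlib anchors used rather than re-defined: `Path.segment`, `Path.trans`, `Path.refl`,
`Path.toContinuousMap`, `ContinuousMap.const`, `SimpleGraph.Walk` (`support`, `darts`, `IsPath`),
`SimpleGraph.Dart`, `borel`, `BorelSpace`, `MeasureTheory.Measure.map`. Mathlib has no polyline /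
piecewise-linear path constructor (grep `polyline`, `piecewiseLinear` returns nothing).
-/

namespace Literature.Probability.LatticeModels

open MeasureTheory

noncomputable section

/-! ### Polylines -/

section Polyline

variable {E : Type*} [AddCommGroup E] [Module ℝ E] [TopologicalSpace E] [ContinuousAdd E]
  [ContinuousSMul ℝ E]

/-- The piecewise-linear path starting at `a` and visiting the points of `l` in order, together
with its endpoint (the last element of `a :: l`): `polylineFrom a [] = refl a` and
`polylineFrom a (b :: l) = (segment a b).trans (polylineFrom b l)`. The parametrisation is the
dyadic one of iterated `Path.trans` (with `n` segments, the `k`-th segment, `0 ≤ k < n`, is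
traversed in time `2^{-(k+1)}`, and the final `Path.refl` occupies the remaining `2^{-n}` as a
constant tail), not the uniform one. (Camia–Newman 2007, §2: lattice paths as polygonal
curves.) [cite: CamiaNewman2007, §2: lattice paths as polygonal curves] -/
def polylineFrom (a : E) : List E → Σ b : E, Path a b
  | [] => ⟨a, Path.refl a⟩
  | b :: l => ⟨(polylineFrom b l).1, (Path.segment a b).trans (polylineFrom b l).2⟩

/-- `polylineFrom a []` is the constant path. (Camia–Newman 2007, §2.) [cite: CamiaNewman2007, §2] -/
@[simp] theorem polylineFrom_nil (a : E) : polylineFrom a [] = ⟨a, Path.refl a⟩ := rfl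

/-- Unfolding one step of `polylineFrom`. (Camia–Newman 2007, §2.) [cite: CamiaNewman2007, §2] -/
@[simp] theorem polylineFrom_cons (a b : E) (l : List E) :
    polylineFrom a (b :: l) =
      ⟨(polylineFrom b l).1, (Path.segment a b).trans (polylineFrom b l).2⟩ := rfl

/-- The endpoint of `polylineFrom a l` is the last element of `a :: l`.
(Camia–Newman 2007, §2.) [cite: CamiaNewman2007, §2] -/
theorem polylineFrom_fst (a : E) (l : List E) :
    (polylineFrom a l).1 = (a :: l).getLast (by simp) := by
  induction l generalizing a with
  | nil => simp
  | cons b l ih =>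
    rw [polylineFrom_cons, ih]
    exact (List.getLast_cons (List.cons_ne_nil b l)).symm

/-- The polyline (piecewise-linear continuous curve `[0, 1] → E`) through the points of `l` in
order, built from `Path.segment`/`Path.trans`; hence the time parametrisation is the *dyadic*
one produced by `trans` (segment `k` in time `2^{-(k+1)}`, constant tail of length `2^{-n}`, see
`polylineFrom`), NOT the uniform one (irrelevant modulo reparametrisation). Junk values:
`polyline [] = 0` (constant), `polyline [a] = a` (constant). (Camia–Newman 2007, §2; Smirnov
2001, §2: discrete interfaces regarded as curves in the plane.) [cite: CamiaNewman2007, §2] -/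
def polyline : List E → C(unitInterval, E)
  | [] => ContinuousMap.const _ 0
  | a :: l => (polylineFrom a l).2.toContinuousMap

/-- The empty polyline is the junk constant `0`. (Camia–Newman 2007, §2.) [cite: CamiaNewman2007, §2] -/
@[simp] theorem polyline_nil : polyline ([] : List E) = ContinuousMap.const _ 0 := rfl

/-- A nonempty polyline starts at the head of the list. (Camia–Newman 2007, §2.) [cite: CamiaNewman2007, §2] -/
@[simp] theorem polyline_apply_zero (a : E) (l : List E) : polyline (a :: l) 0 = a := by
  simp [polyline]

/-- A nonempty polyline ends at the last point of the list. (Camia–Newman 2007, §2.) [cite: CamiaNewman2007, §2] -/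
theorem polyline_apply_one (a : E) (l : List E) :
    polyline (a :: l) 1 = (a :: l).getLast (by simp) := by
  rw [← polylineFrom_fst]
  simp [polyline]

/-- `polylineFrom a l` passes through every point of `a :: l`. (Camia–Newman 2007, §2.) [cite: CamiaNewman2007, §2] -/
theorem mem_range_polylineFrom (a : E) (l : List E) {x : E} (hx : x ∈ a :: l) :
    x ∈ Set.range (polylineFrom a l).2 := by
  induction l generalizing a with
  | nil =>
    rw [List.mem_singleton] at hx
    subst hx
    exact ⟨0, rfl⟩
  | cons b l ih =>
    rw [polylineFrom_cons, Path.trans_range]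
    rcases List.mem_cons.1 hx with rfl | h
    · left
      rw [Path.range_segment]
      exact left_mem_segment ℝ x b
    · right
      exact ih b h

/-- The polyline passes through every point of the list. (Camia–Newman 2007, §2.) [cite: CamiaNewman2007, §2] -/
theorem mem_range_polyline {l : List E} {x : E} (hx : x ∈ l) : x ∈ Set.range (polyline l) := by
  cases l with
  | nil => simp at hx
  | cons a l => exact mem_range_polylineFrom a l hx

end Polyline

end

end Literature.Probability.LatticeModels

/-! ### Walks as curves -/

namespace SimpleGraph.Walk

section ToCurve

variable {V E : Type*} [AddCommGroup E] [Module ℝ E] [TopologicalSpace E] [ContinuousAdd E]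
  [ContinuousSMul ℝ E] {G : SimpleGraph V} {u v : V}

/-- The continuous curve traced by a walk `w` of a graph whose vertices are embedded in a real
topological vector space by `emb`: the polyline through `w.support.map emb`. This is a deliberate
dot-notation extension of Mathlib's `SimpleGraph.Walk` namespace. (Camia–Newman 2007, §2;
Smirnov 2001, §2.) [cite: CamiaNewman2007, §2] -/
noncomputable def toCurve (emb : V → E) (w : G.Walk u v) : C(unitInterval, E) :=
  Literature.Probability.LatticeModels.polyline (w.support.map emb)

/-- The curve of a walk starts at the (embedded) initial vertex. (Camia–Newman 2007, §2.) [cite: CamiaNewman2007, §2] -/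
@[simp] theorem toCurve_apply_zero (emb : V → E) (w : G.Walk u v) : w.toCurve emb 0 = emb u := by
  cases w <;> simp [toCurve]

/-- The curve of a walk passes through every (embedded) vertex of its support.
(Camia–Newman 2007, §2.) [cite: CamiaNewman2007, §2] -/
theorem mem_range_toCurve (emb : V → E) (w : G.Walk u v) {x : V} (hx : x ∈ w.support) :
    emb x ∈ Set.range (w.toCurve emb) :=
  Literature.Probability.LatticeModels.mem_range_polyline (List.mem_map_of_mem hx)

end ToCurve

end SimpleGraph.Walk

namespace Literature.Probability.LatticeModels

open MeasureTheory

noncomputable section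

/-! ### Dobrushin data -/

/-- Discrete Dobrushin (two-arc) boundary data for a planar lattice model: a domain `Ω ⊆ ℂ`, a
mesh size `δ`, and two boundary arcs `arcA`, `arcB ⊆ ∂Ω` (data only; in applications the arcs are
the two arcs cut out by two marked prime ends / boundary points `a`, `b` of a T-STOCH marked
domain). (Smirnov 2001, §2; Camia–Newman 2007, §2.) [cite: Smirnov2001, §2] -/
structure DiscreteDobrushin where
  /-- The planar domain. -/
  Ω : Set ℂ
  /-- The mesh size. -/
  δ : ℝ
  /-- The boundary arc carrying the "open"/`+` boundary condition. -/
  arcA : Set ℂ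
  /-- The boundary arc carrying the "closed"/`−` boundary condition. -/
  arcB : Set ℂ

namespace DiscreteDobrushin

variable (D : DiscreteDobrushin)

/-- The discretisation on `δ𝕋` of the arc `A`: `triDiscreteArc Ω δ arcA`. (Smirnov 2001, §2.) [cite: Smirnov2001, §2] -/
def triArcA : Set (Site 2) := triDiscreteArc D.Ω D.δ D.arcA

/-- The discretisation on `δ𝕋` of the arc `B`: `triDiscreteArc Ω δ arcB`. (Smirnov 2001, §2.) [cite: Smirnov2001, §2] -/
def triArcB : Set (Site 2) := triDiscreteArc D.Ω D.δ D.arcB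

/-- The site configuration with Dobrushin boundary conditions imposed: sites of the discrete arc
of `A` are open, sites of the discrete arc of `B` (not in that of `A`) are closed, and all other
sites keep their colour in `ω`; if the two discrete arcs overlap, `A` wins on the overlap
(disjointness is a hypothesis of `IsAdmissible`, not of this definition). (Smirnov 2001, §2:
"colour the hexagons of the arc `ab` blue and those of `ba` yellow"; Camia–Newman 2007, §2.) [cite: Smirnov2001, §2: "colour the hexagons of the arc  ab] -/
def bcConfig (ω : Percolation.SiteConfig (Site 2)) : Percolation.SiteConfig (Site 2) :=
  {x | x ∈ D.triArcA ∨ (x ∉ D.triArcB ∧ x ∈ ω)}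

/-- Arc-`A` sites are open under the boundary condition. (Smirnov 2001, §2.) [cite: Smirnov2001, §2] -/
theorem mem_bcConfig_of_mem_triArcA {ω : Percolation.SiteConfig (Site 2)} {x : Site 2} (hx : x ∈ D.triArcA) :
    x ∈ D.bcConfig ω :=
  Or.inl hx

/-- Arc-`B` sites off the arc of `A` are closed under the boundary condition.
(Smirnov 2001, §2.) [cite: Smirnov2001, §2] -/
theorem notMem_bcConfig_of_mem_triArcB {ω : Percolation.SiteConfig (Site 2)} {x : Site 2}
    (hx : x ∈ D.triArcB) (hx' : x ∉ D.triArcA) : x ∉ D.bcConfig ω := by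
  rintro (h | h)
  · exact hx' h
  · exact h.1 hx

/-- Away from both discrete arcs the boundary condition does not change the colour.
(Smirnov 2001, §2.) [cite: Smirnov2001, §2] -/
theorem mem_bcConfig_iff_of_notMem {ω : Percolation.SiteConfig (Site 2)} {x : Site 2} (hA : x ∉ D.triArcA)
    (hB : x ∉ D.triArcB) : x ∈ D.bcConfig ω ↔ x ∈ ω := by
  simp [bcConfig, hA, hB]

/-- A face of `𝕋` (vertex of the honeycomb lattice) *touches both arcs* if it has a vertex on the
discrete arc of `A` and a vertex on the discrete arc of `B`. Every face bordering an `A`–`B` dart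
of `𝕋` touches both arcs (`touchesBothArcs_of_triEdgeFaces`), and, since the three vertices of a
face are pairwise adjacent, the converse holds when the two discrete arcs are disjoint
(`touchesBothArcs_iff`; the discrete arcs `triDiscreteArc` are defined with `≤` on `infDist` and
may share tie sites in general); every `A`–`B` edge borders two such faces, so a Dobrushin
domain with two marked points `a ≠ b` has (generically) four faces touching both arcs — the
inner and outer faces of the `A`–`B` boundary edges at `a` and at `b` — and the exploration path
visits all four
(`IsExplorationPath`). (Smirnov 2001, §2; Camia–Newman 2007, §2.) [cite: Smirnov2001, §2] -/
def TouchesBothArcs (f : HexVertex) : Prop :=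
  (∃ x ∈ hexFaceVertices f, x ∈ D.triArcA) ∧ ∃ y ∈ hexFaceVertices f, y ∈ D.triArcB

/-- Both faces bordering a dart of `𝕋` from the discrete arc of `A` to the discrete arc of `B`
touch both arcs (both endpoints of a dart are vertices of its left and of its right face).
(Smirnov 2001, §2.) Sorried: unfolding of `triEdgeFaces`/`hexFaceVertices` (outline R4). [cite: Smirnov2001, §2] -/
def touchesBothArcs_of_triEdgeFaces : Prop :=
  ∀ {f : HexVertex} (e : triGraph.Dart) (hA : e.fst ∈ D.triArcA) (hB : e.snd ∈ D.triArcB) (hf : f = (triEdgeFaces e).1 ∨ f = (triEdgeFaces e).2),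
    D.TouchesBothArcs f

/-- Characterisation of the faces touching both arcs when the discrete arcs are disjoint: `f`
touches both arcs iff it is one of the two faces bordering a dart of `𝕋` from the discrete arc
of `A` to the discrete arc of `B`. The disjointness hypothesis is needed for `→`: the witnesses
`x ∈ triArcA`, `y ∈ triArcB` among the (pairwise `𝕋`-adjacent) vertices of `f` must be
distinct to span a dart. (Smirnov 2001, §2.) Sorried: finite case analysis on the three vertices
of a face (outline R4). [cite: Smirnov2001, §2] -/
def touchesBothArcs_iff : Prop :=
  ∀ (hD : Disjoint D.triArcA D.triArcB) (f : HexVertex),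
    D.TouchesBothArcs f ↔ ∃ e : triGraph.Dart, e.fst ∈ D.triArcA ∧ e.snd ∈ D.triArcB ∧
      (f = (triEdgeFaces e).1 ∨ f = (triEdgeFaces e).2)

/-- The `A`–`B` darts of the discrete domain: darts `x → y` of `𝕋` with `x` on the discrete arc
of `A`, `y` on the discrete arc of `B`, and `{x, y}` an edge of `Ω_δ = triDiscreteDomainGraph`.
In a Dobrushin domain with marked boundary points `a ≠ b` there are (generically) exactly two of
them, the boundary edges `e_a` at `a` and `e_b` at `b`; the exploration path starts by crossing
one of them (from its outer face `a_δ` to its inner face) and ends by crossing the other (from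
its inner face to its outer face `b_δ`). The count `abDarts.ncard = 2` alone does not make the
exploration path unique (see `IsAdmissible`); the relevant hypothesis is on the outer faces
`abFaces`. (Smirnov 2001, §2; Camia–Newman 2007, §2, Fig. 1.) [cite: Smirnov2001, §2] -/
def abDarts : Set triGraph.Dart :=
  {e | e.fst ∈ D.triArcA ∧ e.snd ∈ D.triArcB ∧ (triDiscreteDomainGraph D.Ω D.δ).Adj e.fst e.snd}

/-- Membership in `abDarts`, unfolded. (Smirnov 2001, §2.) [cite: Smirnov2001, §2] -/
@[simp] theorem mem_abDarts_iff {e : triGraph.Dart} :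
    e ∈ D.abDarts ↔
      e.fst ∈ D.triArcA ∧ e.snd ∈ D.triArcB ∧ (triDiscreteDomainGraph D.Ω D.δ).Adj e.fst e.snd :=
  Iff.rfl

/-- The *outer* `A`–`B` faces of the discrete domain: faces of `𝕋` bordering an `A`–`B` dart of
`Ω_δ` (`abDarts`) whose vertex set is not contained in `Ω_δ` (the third vertex lies outside the
discrete domain). With the boundary condition imposed these are exactly the faces of degree `1`
in the digraph of exploration steps (one step leaves or enters them, across the `A`–`B` edge, and
no other step is possible since their other two edges are not edges of `Ω_δ`); in a Dobrushin
domain with marked points `a ≠ b` there are exactly two of them, `a_δ` and `b_δ`, the endpoints of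
the exploration path. (Smirnov 2001, §2; Camia–Newman 2007, §2, Fig. 1.) [cite: Smirnov2001, §2] -/
def abFaces : Set HexVertex :=
  {f | ∃ e ∈ D.abDarts, (f = (triEdgeFaces e).1 ∨ f = (triEdgeFaces e).2) ∧
    ¬ (↑(hexFaceVertices f) : Set (Site 2)) ⊆ triMeshDomain D.Ω D.δ}

/-- Membership in `abFaces`, unfolded. (Smirnov 2001, §2.) [cite: Smirnov2001, §2] -/
@[simp] theorem mem_abFaces_iff {f : HexVertex} :
    f ∈ D.abFaces ↔ ∃ e ∈ D.abDarts, (f = (triEdgeFaces e).1 ∨ f = (triEdgeFaces e).2) ∧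
      ¬ (↑(hexFaceVertices f) : Set (Site 2)) ⊆ triMeshDomain D.Ω D.δ :=
  Iff.rfl

/-- Every outer `A`–`B` face touches both arcs. (Smirnov 2001, §2.) Immediate from
`touchesBothArcs_of_triEdgeFaces` (no disjointness hypothesis needed). [cite: Smirnov2001, §2] -/
def touchesBothArcs_of_mem_abFaces : Prop :=
  ∀ {f : HexVertex} (hf : f ∈ D.abFaces),
    D.TouchesBothArcs f

/- interim proof relied on results that are now named facts (D-0014); demoted to a fact by the M5 import, proof preserved:
:= by
  obtain ⟨e, he, hfe, -⟩ := hf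
  exact D.touchesBothArcs_of_triEdgeFaces e he.1 he.2.1 hfe
-/

/-- If there is an outer `A`–`B` face then there is an `A`–`B` dart. (Smirnov 2001, §2.) [cite: Smirnov2001, §2] -/
theorem abDarts_nonempty_of_abFaces_nonempty (h : D.abFaces.Nonempty) : D.abDarts.Nonempty := by
  obtain ⟨f, e, he, -⟩ := h
  exact ⟨e, he⟩

/-- Admissibility of Dobrushin data for the hexagonal exploration process: bounded domain,
positive mesh, disjoint nonempty discrete arcs which together cover the discrete boundary
`∂Ω_δ` (this is the content of "Dobrushin boundary conditions": every boundary hexagon is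
coloured, so the interface cannot stop inside the domain), every `A`–`B` adjacency of `𝕋` is an
edge of `Ω_δ` (so no face of `Ω_δ` has an uncounted `A`–`B` side), and exactly two *outer*
`A`–`B` faces (`abFaces`: the faces `a_δ`, `b_δ` outside the two boundary `A`–`B` edges at the
discrete marked points). These are the ω-free combinatorial hypotheses under which the (maximal)
exploration path is well defined and unique: the faces of step-degree `1` are exactly the two
outer faces, every other face has in-degree = out-degree `≤ 1`. (The mere count
`abDarts.ncard = 2` would not suffice: a one-site-thick strip has two `A`–`B` darts but four
outer faces and two maximal step-paths.) (Smirnov 2001, §2; Camia–Newman 2007, §2.) [cite: Smirnov2001, §2] -/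
structure IsAdmissible : Prop where
  /-- The domain is bounded. -/
  isBounded : Bornology.IsBounded D.Ω
  /-- The mesh size is positive. -/
  delta_pos : 0 < D.δ
  /-- The discrete arc of `A` is nonempty. -/
  triArcA_nonempty : D.triArcA.Nonempty
  /-- The discrete arc of `B` is nonempty. -/
  triArcB_nonempty : D.triArcB.Nonempty
  /-- The two discrete arcs are disjoint. -/
  disjoint : Disjoint D.triArcA D.triArcB
  /-- The two discrete arcs cover the discrete boundary. -/
  triMeshBoundary_subset : triMeshBoundary D.Ω D.δ ⊆ D.triArcA ∪ D.triArcB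
  /-- Every `A`–`B` adjacency of `𝕋` is an edge of the discrete domain `Ω_δ`. -/
  adj_of_mem_arcs : ∀ x ∈ D.triArcA, ∀ y ∈ D.triArcB, triGraph.Adj x y →
    (triDiscreteDomainGraph D.Ω D.δ).Adj x y
  /-- Exactly two outer `A`–`B` faces (the endpoints `a_δ`, `b_δ` of the exploration path). -/
  ncard_abFaces_eq_two : D.abFaces.ncard = 2

end DiscreteDobrushin

/-! ### The hexagonal exploration path -/

/-- A dart `f → g` of the honeycomb lattice is an *exploration step* for the Dobrushin data `D` in
the configuration `ω`: it crosses an edge `{x, y}` of the discrete domain `Ω_δ ⊆ δ𝕋`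
(`triDiscreteDomainGraph`) whose endpoint `x` on the left of `f → g` is open and whose endpoint
`y` on the right is closed, colours being taken with the boundary condition imposed
(`DiscreteDobrushin.bcConfig`). Here `x` is on the left of `f → g` iff the dart `x → y` of `𝕋`
has left face `g` and right face `f` (`triEdgeFaces`). (Smirnov 2001, §2; Camia–Newman 2007,
§2, Fig. 1.) [cite: Smirnov2001, §2] -/
def IsExplorationStep (D : DiscreteDobrushin) (ω : Percolation.SiteConfig (Site 2)) (f g : HexVertex) : Prop :=
  ∃ e : triGraph.Dart, triEdgeFaces e = (g, f) ∧
    (triDiscreteDomainGraph D.Ω D.δ).Adj e.fst e.snd ∧ e.fst ∈ D.bcConfig ω ∧ e.snd ∉ D.bcConfig ω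

/-- The walk `γ` on the honeycomb lattice `hexGraph` is *the exploration path* of the site
configuration `ω` in the discrete Dobrushin domain `D`: `γ` is a self-avoiding path with distinct
endpoints, every dart of `γ` is an exploration step (open-or-arc-`A` site on its left,
closed-or-arc-`B` site on its right, crossing an edge of `Ω_δ`), and `γ` is *maximal*: no
exploration step enters its initial face and none leaves its final face. With the boundary
condition imposed every face has at most one incoming and at most one outgoing exploration step,
so a maximal step-path is determined by its initial face; for admissible data
(`DiscreteDobrushin.IsAdmissible`) the initial and final faces are the two outer `A`–`B` faces
`a_δ`, `b_δ` (`DiscreteDobrushin.abFaces`, the only faces of step-degree `1`).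
(Smirnov 2001, §2; Camia–Newman 2007, §2, Fig. 1.) [cite: Smirnov2001, §2] -/
structure IsExplorationPath (D : DiscreteDobrushin) (ω : Percolation.SiteConfig (Site 2)) {f g : HexVertex}
    (γ : hexGraph.Walk f g) : Prop where
  /-- The exploration path is self-avoiding. -/
  isPath : γ.IsPath
  /-- The endpoints are distinct (excludes the trivial walk). -/
  ne : f ≠ g
  /-- Every step has an open site on its left and a closed site on its right. -/
  step : ∀ d ∈ γ.darts, IsExplorationStep D ω d.fst d.snd
  /-- Maximality at the start: no exploration step enters the initial face. -/
  not_step_start : ∀ h, ¬ IsExplorationStep D ω h f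
  /-- Maximality at the end: no exploration step leaves the final face. -/
  not_step_end : ∀ h, ¬ IsExplorationStep D ω g h

/-- Well-definedness of the exploration process: for admissible Dobrushin data, every site
configuration has exactly one (maximal) exploration path, as a walk with its endpoints. This is
the deterministic "turn left at closed, right at open" description of the interface between the
open cluster of the arc `A` and the closed cluster of the arc `B`: in the digraph of exploration
steps every face other than an outer `A`–`B` face (`DiscreteDobrushin.abFaces`) has in-degree =
out-degree `≤ 1` (the arcs cover `∂Ω_δ` and every `A`–`B` adjacency is an edge of `Ω_δ`), the
outer `A`–`B` faces have degree `1`, and there are exactly two of them (`IsAdmissible`), so the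
step digraph has exactly one maximal non-trivial path component, from `a_δ` to `b_δ`.
(Smirnov 2001, §2; Camia–Newman 2007, §2.) Sorried: planar-topology bookkeeping (outline R4);
the admissibility hypotheses are the library's transcription of "Jordan domain with two marked
boundary points and Dobrushin boundary conditions". [cite: Smirnov2001, §2] -/
def existsUnique_explorationPath : Prop :=
  ∀ (D : DiscreteDobrushin) (hD : D.IsAdmissible) (ω : Percolation.SiteConfig (Site 2)),
    ∃! γ : Σ f g : HexVertex, hexGraph.Walk f g, IsExplorationPath D ω γ.2.2

-- `open scoped Classical` only supplies the `Decidable` instance for the `dite` on `∃!`.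

open scoped Classical in
/-- The exploration path of `ω` in `D` as a walk with its endpoints, chosen by
`Exists.choose` when it exists uniquely (`existsUnique_explorationPath`), and `none` otherwise.
(Smirnov 2001, §2; Camia–Newman 2007, §2.) [cite: Smirnov2001, §2] -/
def explorationWalk (D : DiscreteDobrushin) (ω : Percolation.SiteConfig (Site 2)) :
    Option (Σ f g : HexVertex, hexGraph.Walk f g) :=
  if h : ∃! γ : Σ f g : HexVertex, hexGraph.Walk f g, IsExplorationPath D ω γ.2.2 then
    some h.exists.choose
  else none

/-- When it is defined, `explorationWalk` is an exploration path. (Smirnov 2001, §2.) [cite: Smirnov2001, §2] -/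
theorem isExplorationPath_of_explorationWalk_eq_some {D : DiscreteDobrushin}
    {ω : Percolation.SiteConfig (Site 2)} {γ : Σ f g : HexVertex, hexGraph.Walk f g}
    (h : explorationWalk D ω = some γ) : IsExplorationPath D ω γ.2.2 := by
  unfold explorationWalk at h
  split_ifs at h with h'
  cases h
  exact h'.exists.choose_spec

/-- For admissible data the exploration walk is defined. (Smirnov 2001, §2.) [cite: Smirnov2001, §2] -/
def explorationWalk_isSome : Prop :=
  ∀ (D : DiscreteDobrushin) (hD : D.IsAdmissible) (ω : Percolation.SiteConfig (Site 2)),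
    (explorationWalk D ω).isSome

/- interim proof relied on results that are now named facts (D-0014); demoted to a fact by the M5 import, proof preserved:
:= by
  simp [explorationWalk, existsUnique_explorationPath D hD ω]
-/

/-- The exploration path of `ω` in `D` as a continuous curve `[0, 1] → ℂ`: the polyline through
the rescaled centres `δ · hexCenter` of the faces visited by `explorationWalk D ω`
(`SimpleGraph.Walk.toCurve`), or the junk constant curve `0` if there is no (unique) exploration
path. (Smirnov 2001, §2; Camia–Newman 2007, §2: the percolation exploration path as a random
curve.) [cite: Smirnov2001, §2] -/
def explorationCurve (D : DiscreteDobrushin) (ω : Percolation.SiteConfig (Site 2)) : C(unitInterval, ℂ) :=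
  match explorationWalk D ω with
  | none => ContinuousMap.const _ 0
  | some γ => γ.2.2.toCurve fun f => (D.δ : ℂ) * hexCenter f

/-! ### The law of the exploration curve -/

/-- The Borel σ-algebra on the space of planar curves `C(unitInterval, ℂ)` (compact-open, i.e.
uniform, topology), as a scoped instance: Mathlib equips `ContinuousMap` with no
`MeasurableSpace`, so this neither overrides nor duplicates a Mathlib instance. Note that
`Literature.Stoch` puts `borel` on the *structures* `Curve E` / `CurveClass E` (`H21/Stoch/Curve.lean`,
`H21/Stoch/CurveSpace.lean`), which are different types; the bridge
`C(unitInterval, ℂ) → CurveClass ℂ` is left to the T-STOCH / scaling-limit files — do not add a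
second instance on `C(unitInterval, ℂ)` there, open this scope instead.
(Camia–Newman 2007, §2: laws of random curves for the uniform metric.) -/
scoped instance curveMeasurableSpace : MeasurableSpace C(unitInterval, ℂ) := borel _

/-- `curveMeasurableSpace` is the Borel σ-algebra. (Camia–Newman 2007, §2.) -/
scoped instance curveBorelSpace : BorelSpace C(unitInterval, ℂ) := ⟨rfl⟩

/-- The law of the exploration curve of critical (or density-`p`) site percolation on `δ𝕋` in the
Dobrushin domain `D`: the push-forward of `triSitePercolation p` under `explorationCurve D`.
Caveat (outline §0): `Measure.map` of a non-AE-measurable map is `0`; measurability of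
`explorationCurve D` is assumed/known (for bounded `Ω` and `δ > 0` it has finite range and its
fibres are cylinder events). (Smirnov 2001, §2 and Théorème 2; Camia–Newman 2007, §2.) [cite: Smirnov2001, §2 and Théorème 2] -/
def explorationLaw (D : DiscreteDobrushin) (p : unitInterval) : Measure C(unitInterval, ℂ) :=
  (triSitePercolation p).map (explorationCurve D)

end

end Literature.Probability.LatticeModels
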